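import Summits.QuantumFields.BalabanUV.Beta.GAN24.UnitCovDecay

/-!
# Row G-an2-4 ∕ (CONV-C), target ledger (O-pos)∕(O-id) — THE INSTANCE `θ = L⁻¹` OF THE DECAY-WEIGHTED CAUCHY RATE of the unit-lattice
# readings of Bałaban's (1.18)-averaged free covariance at `U = 1`, AND ITS LIMIT KERNEL
# (companion of `GAN24/UnitCovDecay`; the rate is NE2-p1's `BalabanAveragedTowerUnit.opNorm_unitCovB_sub_le`, the limit is `unitCovB_tendsto`)

NOT IN PRINT; OUR BOOKKEEPING.  Cell `pub-balaban`, G-an2-4 crux team, leaf seat `b2b-balaban-gan24-formalise-leaf-04` (gen 44).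
 * `unitCovB_supCauchy`: the entrywise sup-norm Cauchy rate `‖(unitCovB (k+j) − unitCovB k) e e′‖ ≤ 2·CQB(d,a)·(L⁻¹)^k` (`L ≥ 2`; `norm_entry_le_opNorm`
   + `opNorm_unitCovB_sub_le`, `1/(1 − L⁻¹) ≤ 2`);
 * **`unitCovB_decayCauchy`**: the instance `θ = L⁻¹`, `ε = 2·CQB` of `UnitCovDecay.unitCovB_decayCauchy_of_supCauchy`: ONE pair `κ, C` depending on
   `(d, a)` only with, for every `L ≥ 2`, `M_μ ≥ 2`: uniform decay `‖unitCovB k e e′‖ ≤ C·e^{−κ·ldist}` ∧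
   `‖(unitCovB (k+j) − unitCovB k) e e′‖ ≤ C·(√(L⁻¹))^k·e^{−(κ/2)·ldist(e.1, e′.1)}` — the (O-pos) shape for ONE constituent at the WEAK exponent;
 * **`unitCovB_limit_decay`**: for ANY operator-norm limit `c_∞` of the tower (it exists by `unitCovB_tendsto`): `‖c_∞ e e′‖ ≤ C·e^{−κ·ldist}` ∧
   `‖(unitCovB k − c_∞) e e′‖ ≤ C·(√(L⁻¹))^k·e^{−(κ/2)·ldist}` — the shape «|𝒦^{(k)} − 𝒦^{(∞)}|(y,y′) ≤ c₀θ^k e^{−δ|y−y′|}» WITH AN IDENTIFIED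
   LIMIT OBJECT (entries converge under operator-norm convergence, `norm_entry_le_opNorm`; a bound holding up to a vanishing error holds).
HONEST FRAMING as in `UnitCovDecay`: `U = 1`, finite tori, the averaged FREE covariance only; [folklore] over tree modules BY NAME; no `def … : Prop`;
nothing printed used; 0 sorry; κ EXISTENTIAL; no identification of `c_∞` with a continuum ∕ perfect-lattice object is claimed ((O-id)∕R4 of
`ROUTES-GAN24.md`); NEVER «G-an2-4 closed», NOT D1, NOT BetaPertH, NOT continuum, NOT Clay.  HONEST DEPENDENCY: continuum YM on T⁴ ⇐ BetaPertH ∧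
nine spine estimates (0/9 proved); BetaPertH ⇐ (D1) ∧ (D4) ∧ CAP+tail; G-an2-4 gates asym, D1 and NE2/3/4.
-/

noncomputable section

open scoped Matrix Matrix.Norms.L2Operator Topology
open Filter

namespace Summit.QuantumFields.BalabanUV.Beta.GAN24.UnitCovDecayRate

open Literature.MathematicalPhysics.QuantumFieldTheory.Balaban1983to89
open B5Prop11Plancherel (Tor fine)
open B5G183RateUnitTower (lev lev_neZero)
open Beta.TorusG0Decay (ldist)
open Summit.QuantumFields.BalabanUV.T4Continuum.BalabanLineAverage (CQB CQB_nonneg)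
open Summit.QuantumFields.BalabanUV.T4Continuum.BalabanAveragedTowerUnit (idx unitCovB opNorm_unitCovB_sub_le norm_entry_le_opNorm)
open Summit.QuantumFields.BalabanUV.Beta.GAN24.UnitCovDecay (unitCovB_decayCauchy_of_supCauchy)

variable {d : ℕ}

/-- entries converge (in norm) when matrices converge in the `ℓ²`-operator norm. [folklore] -/
theorem entry_tendsto {m n : Type*} [Fintype m] [DecidableEq m] [Fintype n] [DecidableEq n]
    {X : ℕ → Matrix m n ℂ} {Y : Matrix m n ℂ} (h : Tendsto X atTop (𝓝 Y)) (i : m) (j : n) :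
    Tendsto (fun k => ‖(X k - Y) i j‖) atTop (𝓝 0) :=
  squeeze_zero (fun _ => norm_nonneg _) (fun k => norm_entry_le_opNorm (X k - Y) i j)
    (tendsto_iff_norm_sub_tendsto_zero.mp h)

variable (L : ℕ) [NeZero L] (M : Fin d → ℕ) [hM : ∀ μ, NeZero (M μ)] (a : ℝ) (ha : 0 < a)

/-- **the entrywise sup-norm Cauchy rate at `θ = L⁻¹`**: `‖(unitCovB (k+j) − unitCovB k) e e′‖ ≤ 2·CQB(d,a)·(L⁻¹)^k` for `L ≥ 2`
(entry ≤ operator norm ≤ `CQB·L^{−k}/(1 − L⁻¹)`, and `1/(1 − L⁻¹) ≤ 2`). [folklore] -/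
theorem unitCovB_supCauchy (hL : 2 ≤ L) (k j : ℕ) (e e' : idx L M 0) :
    ‖(unitCovB L M a ha (k + j) - unitCovB L M a ha k) e e'‖ ≤ 2 * CQB d a * ((L : ℝ)⁻¹) ^ k := by
  have hLinv0 : (0 : ℝ) ≤ (L : ℝ)⁻¹ := inv_nonneg.mpr (Nat.cast_nonneg _)
  have hLinv : (L : ℝ)⁻¹ ≤ 1 / 2 := by
    rw [inv_eq_one_div]
    exact one_div_le_one_div_of_le two_pos (by exact_mod_cast hL)
  have h1 : ‖(unitCovB L M a ha (k + j) - unitCovB L M a ha k) e e'‖ ≤ ‖unitCovB L M a ha (k + j) - unitCovB L M a ha k‖ :=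
    norm_entry_le_opNorm _ _ _
  have h2 : ‖unitCovB L M a ha (k + j) - unitCovB L M a ha k‖ ≤ CQB d a * ((L : ℝ)⁻¹) ^ k / (1 - (L : ℝ)⁻¹) := by
    rw [← norm_neg, neg_sub]
    exact opNorm_unitCovB_sub_le L M a ha hL k j
  have h3 : CQB d a * ((L : ℝ)⁻¹) ^ k / (1 - (L : ℝ)⁻¹) ≤ 2 * CQB d a * ((L : ℝ)⁻¹) ^ k := by
    rw [div_le_iff₀ (by linarith)]
    have h0 : 0 ≤ CQB d a * ((L : ℝ)⁻¹) ^ k := mul_nonneg (CQB_nonneg d a) (pow_nonneg hLinv0 k)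
    nlinarith
  linarith

/-- **THE DECAY-WEIGHTED CAUCHY RATE AT `θ = L⁻¹`** (instance of `unitCovB_decayCauchy_of_supCauchy`): ONE pair `κ, C > 0` depending on `(d, a)`
only such that for every `L ≥ 2`, every torus with `M_μ ≥ 2`: `‖unitCovB k e e′‖ ≤ C·e^{−κ·ldist}` for all `k, e, e′`, and
`‖(unitCovB (k+j) − unitCovB k) e e′‖ ≤ C·(√(L⁻¹))^k·e^{−(κ/2)·ldist(e.1, e′.1)}` for all `k, j, e, e′`. [folklore] -/
theorem unitCovB_decayCauchy :
    ∃ κ C : ℝ, 0 < κ ∧ 0 < C ∧ ∀ (L : ℕ) [NeZero L] (M : Fin d → ℕ) [∀ μ, NeZero (M μ)], 2 ≤ L → (∀ μ, 2 ≤ M μ) →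
      (∀ (k : ℕ) (e e' : idx L M 0), ‖unitCovB L M a ha k e e'‖ ≤ C * Real.exp (-(κ * ldist (fine (lev L 0) M) e.1 e'.1))) ∧
      ∀ (k j : ℕ) (e e' : idx L M 0), ‖(unitCovB L M a ha (k + j) - unitCovB L M a ha k) e e'‖
          ≤ C * Real.sqrt ((L : ℝ)⁻¹) ^ k * Real.exp (-(κ / 2 * ldist (fine (lev L 0) M) e.1 e'.1)) := by
  obtain ⟨κ, C, hκ, hC, h⟩ := unitCovB_decayCauchy_of_supCauchy (d := d) a ha
  refine ⟨κ, C + Real.sqrt (2 * C * (2 * CQB d a)), hκ, by positivity, ?_⟩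
  intro L _ M _ hL hM2
  obtain ⟨hdec, hgen⟩ := h L M hM2
  have hCle : C ≤ C + Real.sqrt (2 * C * (2 * CQB d a)) := le_add_of_nonneg_right (Real.sqrt_nonneg _)
  refine ⟨fun k e e' => (hdec k e e').trans (mul_le_mul_of_nonneg_right hCle (Real.exp_pos _).le), fun k j e e' => ?_⟩
  have hmain := hgen ((L : ℝ)⁻¹) (2 * CQB d a) (inv_nonneg.mpr (Nat.cast_nonneg _))
    (mul_nonneg two_pos.le (CQB_nonneg d a)) (fun k j e e' => unitCovB_supCauchy L M a ha hL k j e e') k j e e'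
  refine hmain.trans (mul_le_mul_of_nonneg_right (mul_le_mul_of_nonneg_right ?_ (pow_nonneg (Real.sqrt_nonneg _) k))
    (Real.exp_pos _).le)
  exact le_add_of_nonneg_left hC.le

/-- **THE LIMIT KERNEL DECAYS AND IS APPROACHED AT THE DECAY-WEIGHTED RATE** (same `κ, C` as `unitCovB_decayCauchy`; `L ≥ 2`, `M_μ ≥ 2`;
`c_∞` any operator-norm limit of the tower — it exists by `BalabanAveragedTowerUnit.unitCovB_tendsto`). [folklore] -/
theorem unitCovB_limit_decay :
    ∃ κ C : ℝ, 0 < κ ∧ 0 < C ∧ ∀ (L : ℕ) [NeZero L] (M : Fin d → ℕ) [∀ μ, NeZero (M μ)], 2 ≤ L → (∀ μ, 2 ≤ M μ) →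
      ∀ cinf : Matrix (idx L M 0) (idx L M 0) ℂ, Tendsto (unitCovB L M a ha) atTop (𝓝 cinf) →
        (∀ e e' : idx L M 0, ‖cinf e e'‖ ≤ C * Real.exp (-(κ * ldist (fine (lev L 0) M) e.1 e'.1))) ∧
        ∀ (k : ℕ) (e e' : idx L M 0), ‖(unitCovB L M a ha k - cinf) e e'‖
          ≤ C * Real.sqrt ((L : ℝ)⁻¹) ^ k * Real.exp (-(κ / 2 * ldist (fine (lev L 0) M) e.1 e'.1)) := by
  obtain ⟨κ, C, hκ, hC, h⟩ := unitCovB_decayCauchy (d := d) a ha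
  refine ⟨κ, C, hκ, hC, ?_⟩
  intro L _ M _ hL hM2 cinf hlim
  obtain ⟨hdec, hcau⟩ := h L M hL hM2
  have hent : ∀ e e' : idx L M 0, Tendsto (fun k => ‖(unitCovB L M a ha k - cinf) e e'‖) atTop (𝓝 0) :=
    fun e e' => entry_tendsto hlim e e'
  refine ⟨fun e e' => ?_, fun k e e' => ?_⟩
  · refine le_of_forall_pos_lt_add fun ε hε => ?_
    obtain ⟨k, hk⟩ := ((hent e e').eventually (gt_mem_nhds hε)).exists
    have hsplit : cinf e e' = unitCovB L M a ha k e e' - (unitCovB L M a ha k - cinf) e e' := by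
      rw [Matrix.sub_apply]; ring
    calc ‖cinf e e'‖ ≤ ‖unitCovB L M a ha k e e'‖ + ‖(unitCovB L M a ha k - cinf) e e'‖ := by
          rw [hsplit]; exact (norm_sub_le _ _).trans (by rw [Matrix.sub_apply])
      _ < C * Real.exp (-(κ * ldist (fine (lev L 0) M) e.1 e'.1)) + ε := add_lt_add_of_le_of_lt (hdec k e e') hk
  · refine le_of_forall_pos_lt_add fun ε hε => ?_
    obtain ⟨j, hj⟩ := (((hent e e').comp (tendsto_add_atTop_nat k)).eventually (gt_mem_nhds hε)).exists
    have hsplit : (unitCovB L M a ha k - cinf) e e'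
        = -((unitCovB L M a ha (k + j) - unitCovB L M a ha k) e e') + (unitCovB L M a ha (j + k) - cinf) e e' := by
      simp only [Matrix.sub_apply, add_comm j k]; ring
    calc ‖(unitCovB L M a ha k - cinf) e e'‖
        ≤ ‖(unitCovB L M a ha (k + j) - unitCovB L M a ha k) e e'‖ + ‖(unitCovB L M a ha (j + k) - cinf) e e'‖ := by
          rw [hsplit]; exact (norm_add_le _ _).trans (by rw [norm_neg])
      _ < C * Real.sqrt ((L : ℝ)⁻¹) ^ k * Real.exp (-(κ / 2 * ldist (fine (lev L 0) M) e.1 e'.1)) + ε :=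
          add_lt_add_of_le_of_lt (hcau k j e e') hj

end Summit.QuantumFields.BalabanUV.Beta.GAN24.UnitCovDecayRate

end
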